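import Mathlib
import HarnessLib
import Literature.Analysis.FluidPDE.Tao2016AveragedNS.RenormalisedCascadeWaves
import Literature.Analysis.FluidPDE.Tao2016AveragedNS.SelfSimilarCascadeBlowup
import Literature.Analysis.FluidPDE.Tao2016AveragedNS.BoundedEternalSolutions
import Summits.NavierStokesRegularity.NavierStokesRegularity.Theorems.WakeRatchetAdmissibleEternalBoundCritical
import Summits.NavierStokesRegularity.NavierStokesRegularity.Theorems.TaoLadderRungTwoBreakNoSurvivingEternalViscBddOneWeightedGrowth

/-!
# Crux `TaoLadderRungTwoBreak.NoSurvivingDSSOne` (stmt-NavierStokesRegularity-20205): the SMALL-RATIO NORMAL FORM of a surviving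
# admissible DSS wave — a weakly damped front of the UNIFORM lattice with O(1) lag, O(1) mass and amplitude bounded below

MODEL lattice ODEs only (Tao 2016 §4, §6.4; cell vocabulary `IsDSSWave`, `IsSWave`, `sMass`, `wEnergy`, `Surviving`, `dssMu`);
nothing here is a statement about the Navier–Stokes equations; no stub, crux or summit is closed (`--supports
stmt-NavierStokesRegularity-20205`).

THE RESCALING (exact covariance, `isSWave_rescale`).  If `Φ` is an admissible DSS wave of the table `α` at scale ratio `1+ε₀` with
delay `T` (`IsDSSWave ε₀ α π T Φ`: the profile system with damping `1`, feed `Λ`, drain `Λ⁻¹`), then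
`Ψ_r(ξ) := ε₀ · Φ_r(ε₀ ξ)` solves the tree's abstract profile system `IsSWave π Q A B d c₁ c₂ τ` of the SAME table with
**damping `d = ε₀`, feed `Λ`, drain `Λ⁻¹` and lag `τ = T/ε₀`** (degree-two homogeneity of `Q`, `A`, `B`).  The admissibility data
transform covariantly: `sMass Ψ ξ = ε₀·sMass Φ (ε₀ξ)` (`sMass_rescale`), the mass `∫ sMass` is INVARIANT (`integral_sMass_rescale`,
`integrable_sMass_rescale`), `wEnergy ε₀ Ψ ξ = ε₀²·wEnergy 1 Φ (ε₀ξ)` (`wEnergy_rescale`).  For a SURVIVING delay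
(`Surviving 1 ε₀ T`: `(1+ε₀)⁻¹ ≤ μ < 1`) the lag is pinned to an O(1) window, `2/(1+ε₀) ≤ τ < 5/2` (`rescaled_lag_window`, from
`surviving_delay_window`: `2·log(1+ε₀) ≤ T < (5/2)·log(1+ε₀)`), and by the `1/ε₀` amplitude floor of `…WeightedGrowth`
(`dss_amplitude_floor`) the rescaled profiles are bounded BELOW by an O(1) constant: `sup‖Ψ‖ ≥ ε₀Λ/(C_A(Λ²−1)) → 1/(5C_A)`
(`rescaled_amplitude_floor`).  Assembled: `smallRatio_normalForm`.

READING.  As `ε₀ → 0` a surviving DSS wave is, after rescaling, a front of the λ = 1 lattice (`d = 0`, `c₁ = c₂ = 1` up to `O(ε₀)`)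
with lag `τ ∈ [2, 5/2]`, the same (scale-invariant) mass and period, and amplitude `≳ 1/(5C_A)` — exactly the objects of the tree's
Theorem A / A′ (`CascadeFrontFloors`: a λ = 1 front must leave a trailing-energy floor `exp(−2C_AMτ − 1/4)/(256q(C_Aτ)²)`), whereas
(S₁)-survival lets the wake fraction be at most `1 − (1+ε₀)⁻¹ ≈ ε₀`.  What K1(1) for DSS waves of mass `≤ M` and period `≤ q` needs
beyond the tree is therefore ONE estimate: a `d`-UNIFORM version of Theorem A′ for small damping `d ∈ [0, ε₀]` (the tree's B′-lag floor
degenerates like `d²`).  HONEST LABEL: ⟨20205⟩, (ρ0) and every NS statement remain OPEN.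
-/

noncomputable section

-- the summit and its single sub-problem share the name (CONVENTIONS §1)
set_option linter.dupNamespace false

namespace Summit.NavierStokesRegularity.NavierStokesRegularity.Theorems.NoSurvivingDSSOne.NormalForm

open Set Filter Topology MeasureTheory
open Literature.Analysis.FluidPDE Literature.Analysis.FluidPDE.TaoCascade
open Summit.NavierStokesRegularity.NavierStokesRegularity.Theorems.WakeRatchetCritical
  (tableQ_smul tableA_smul tableB_smul_smul)
open Summit.NavierStokesRegularity.NavierStokesRegularity.Theorems.NoSurvivingEternalViscBddOne.WeightedGrowth
  (dss_amplitude_floor)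

variable {m : ℕ} {ρ : Type*} [Fintype ρ]

omit [Fintype ρ] in
/-- **Exact rescaling covariance.**  The profile system of an admissible DSS wave at scale ratio `1+ε₀` with delay `T`
(damping `1`, feed `Λ`, drain `Λ⁻¹`) becomes, for `Ψ_r(ξ) = ε₀·Φ_r(ε₀ξ)`, the profile system of the SAME table with damping `ε₀`,
feed `Λ`, drain `Λ⁻¹` and lag `T/ε₀`.
[cite: Tao2016AveragedNS, §4 Lemma 4.1 (4.8) (degree-two homogeneity of the cascade nonlinearity), §6.4; cell vocabulary `IsSWave`] -/
theorem isSWave_rescale {ε₀ : ℝ} (hε : 0 < ε₀) {α : Fin m → Fin m → Fin m → ℤ × ℤ × ℤ → ℝ}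
    {π : Equiv.Perm ρ} {T : ℝ} {Φ : ρ → ℝ → Em m}
    (hw : IsSWave π (tableQ α) (tableA α) (tableB α) 1 (bigLam ε₀) (bigLam ε₀)⁻¹ T Φ) :
    IsSWave π (tableQ α) (tableA α) (tableB α) ε₀ (bigLam ε₀) (bigLam ε₀)⁻¹ (T / ε₀) (fun r ξ => ε₀ • Φ r (ε₀ * ξ)) := by
  intro r ξ
  have hε0 : ε₀ ≠ 0 := hε.ne'
  -- chain rule: `ξ ↦ Φ r (ε₀ ξ)` then the constant factor `ε₀`
  have h1 := hw r (ε₀ * ξ)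
  have h2 : HasDerivAt (fun ζ : ℝ => ε₀ * ζ) ε₀ ξ := by
    simpa using (hasDerivAt_id ξ).const_mul ε₀
  have h3 := (h1.scomp ξ h2).const_smul ε₀
  have e1 : ε₀ * ξ + T = ε₀ * (ξ + T / ε₀) := by field_simp
  have e2 : ε₀ * ξ - T = ε₀ * (ξ - T / ε₀) := by field_simp
  refine HasDerivAt.congr_deriv (h3.congr_of_eventuallyEq (Eventually.of_forall fun ζ => rfl)) ?_
  rw [e1, e2] at *
  rw [tableQ_smul, tableA_smul, tableB_smul_smul]
  simp only [smul_add, smul_neg, smul_smul, one_smul]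
  module

omit [Fintype ρ] in
/-- Norms rescale linearly: `‖Ψ_r(ξ)‖ = ε₀‖Φ_r(ε₀ξ)‖`. [folklore] -/
theorem norm_rescale {ε₀ : ℝ} (hε : 0 ≤ ε₀) (Φ : ρ → ℝ → Em m) (r : ρ) (ξ : ℝ) :
    ‖ε₀ • Φ r (ε₀ * ξ)‖ = ε₀ * ‖Φ r (ε₀ * ξ)‖ := by
  rw [norm_smul, Real.norm_eq_abs, abs_of_nonneg hε]

/-- The summed mass rescales linearly: `sMass Ψ ξ = ε₀ · sMass Φ (ε₀ξ)`. [cite: Tao2016AveragedNS, §4; cell vocabulary `sMass`] -/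
theorem sMass_rescale {ε₀ : ℝ} (hε : 0 ≤ ε₀) (Φ : ρ → ℝ → Em m) (ξ : ℝ) :
    sMass (fun r ξ => ε₀ • Φ r (ε₀ * ξ)) ξ = ε₀ * sMass Φ (ε₀ * ξ) := by
  simp only [sMass, norm_rescale hε, Finset.mul_sum]

/-- The weighted energy rescales quadratically: `wEnergy ε₀ Ψ ξ = ε₀² · wEnergy 1 Φ (ε₀ξ)`. [cite: Tao2016AveragedNS, §4; cell vocabulary `wEnergy`] -/
theorem wEnergy_rescale {ε₀ : ℝ} (hε : 0 ≤ ε₀) (Φ : ρ → ℝ → Em m) (ξ : ℝ) :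
    wEnergy ε₀ (fun r ξ => ε₀ • Φ r (ε₀ * ξ)) ξ = ε₀ ^ 2 * wEnergy 1 Φ (ε₀ * ξ) := by
  simp only [wEnergy, sEnergy, norm_rescale hε, mul_pow, Finset.mul_sum]
  refine Finset.sum_congr rfl fun r _ => ?_
  rw [show (2 : ℝ) * 1 * (ε₀ * ξ) = 2 * ε₀ * ξ by ring]
  ring

/-- The mass is scale-invariant: `Ψ` has integrable summed mass iff… (here: if) `Φ` does. [folklore] -/
theorem integrable_sMass_rescale {ε₀ : ℝ} (hε : 0 < ε₀) {Φ : ρ → ℝ → Em m} (h : Integrable (sMass Φ)) :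
    Integrable (sMass (fun r ξ => ε₀ • Φ r (ε₀ * ξ))) := by
  have h1 : sMass (fun r ξ => ε₀ • Φ r (ε₀ * ξ)) = fun ξ => ε₀ * sMass Φ (ε₀ * ξ) := funext fun ξ => sMass_rescale hε.le Φ ξ
  rw [h1]
  exact (h.comp_mul_left' hε.ne').const_mul ε₀

/-- The mass is scale-invariant: `∫ sMass Ψ = ∫ sMass Φ`. [folklore] -/
theorem integral_sMass_rescale {ε₀ : ℝ} (hε : 0 < ε₀) (Φ : ρ → ℝ → Em m) :
    ∫ ξ, sMass (fun r ξ => ε₀ • Φ r (ε₀ * ξ)) ξ = ∫ x, sMass Φ x := by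
  have h1 : sMass (fun r ξ => ε₀ • Φ r (ε₀ * ξ)) = fun ξ => ε₀ * sMass Φ (ε₀ * ξ) := funext fun ξ => sMass_rescale hε.le Φ ξ
  rw [h1, integral_const_mul, Measure.integral_comp_mul_left (fun x => sMass Φ x) ε₀, smul_eq_mul,
    abs_of_pos (inv_pos.2 hε), ← mul_assoc, mul_inv_cancel₀ hε.ne', one_mul]

/-! ## The surviving lag window and the amplitude floor in rescaled units -/

/-- **The surviving delay window**: `Surviving 1 ε₀ T` (i.e. `(1+ε₀)⁻¹ ≤ e^{2T}/(1+ε₀)⁵ < 1`) is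
`2·log(1+ε₀) ≤ T < (5/2)·log(1+ε₀)`. [cite: Tao2016AveragedNS, §4 (the weights of (4.1)), §6.4; cell vocabulary `Surviving`, `dssMu`] -/
theorem surviving_delay_window {ε₀ T : ℝ} (hε : 0 < ε₀) (hS : Surviving 1 ε₀ T) :
    2 * Real.log (1 + ε₀) ≤ T ∧ T < 5 / 2 * Real.log (1 + ε₀) := by
  have hb : 0 < 1 + ε₀ := by linarith
  obtain ⟨h1, h2⟩ := hS
  unfold dssMu at h1 h2
  have h5 : 0 < (1 + ε₀) ^ 5 := pow_pos hb 5
  constructor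
  · -- `(1+ε₀)^{-1} (1+ε₀)^5 ≤ e^{2T}`
    have h3 : (1 + ε₀) ^ (4 : ℝ) ≤ Real.exp (2 * T) := by
      have := (le_div_iff₀ h5).1 h1
      have e : (1 + ε₀) ^ (-(1 : ℝ)) * (1 + ε₀) ^ 5 = (1 + ε₀) ^ (4 : ℝ) := by
        rw [show ((1 + ε₀) ^ 5 : ℝ) = (1 + ε₀) ^ (5 : ℝ) by norm_cast, ← Real.rpow_add hb]; norm_num
      rwa [e] at this
    have := Real.log_le_log (Real.rpow_pos_of_pos hb 4) h3
    rw [Real.log_rpow hb, Real.log_exp] at this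
    linarith
  · have h3 : Real.exp (2 * T) < (1 + ε₀) ^ (5 : ℝ) := by
      have := (div_lt_one h5).1 h2
      exact_mod_cast this
    have := Real.log_lt_log (Real.exp_pos _) h3
    rw [Real.log_rpow hb, Real.log_exp] at this
    linarith

/-- **The rescaled lag is O(1)**: for a surviving delay, `2/(1+ε₀) ≤ T/ε₀ < 5/2` (`ε₀/(1+ε₀) ≤ log(1+ε₀) ≤ ε₀`).
[cite: Tao2016AveragedNS, §4, §6.4; cell vocabulary] -/
theorem rescaled_lag_window {ε₀ T : ℝ} (hε : 0 < ε₀) (hS : Surviving 1 ε₀ T) :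
    2 / (1 + ε₀) ≤ T / ε₀ ∧ T / ε₀ < 5 / 2 := by
  obtain ⟨h1, h2⟩ := surviving_delay_window hε hS
  have hb : 0 < 1 + ε₀ := by linarith
  have hlog_le : Real.log (1 + ε₀) ≤ ε₀ := by
    have := Real.log_le_sub_one_of_pos hb; linarith
  have hlog_ge : ε₀ / (1 + ε₀) ≤ Real.log (1 + ε₀) := by
    have h := Real.one_sub_inv_le_log_of_pos hb
    have e : 1 - (1 + ε₀)⁻¹ = ε₀ / (1 + ε₀) := by field_simp; ring
    rwa [e] at h
  constructor
  · rw [le_div_iff₀ hε]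
    have : 2 / (1 + ε₀) * ε₀ = 2 * (ε₀ / (1 + ε₀)) := by ring
    rw [this]; linarith
  · rw [div_lt_iff₀ hε]; linarith

/-- **The amplitude floor in rescaled units**: for a non-trivial admissible DSS wave of a cancelling table with profiles bounded by
`B`, the rescaled profiles `Ψ_r(ξ) = ε₀·Φ_r(ε₀ξ)` are bounded by `ε₀B` and `ε₀B ≥ ε₀Λ/(C_A(Λ²−1))` (`→ 1/(5C_A)` as `ε₀ → 0`):
`ε₀Λ ≤ C_A · (ε₀B) · (Λ²−1)`.
[cite: Tao2016AveragedNS, §4 Lemma 4.1 (4.8)–(4.10), §6.4; tree `dss_amplitude_floor`] -/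
theorem rescaled_amplitude_floor {ε₀ : ℝ} (hε : 0 < ε₀) {α : Fin m → Fin m → Fin m → ℤ × ℤ × ℤ → ℝ}
    (hc : IsCancellingCoeff α) {π : Equiv.Perm ρ} {T : ℝ} {Φ : ρ → ℝ → Em m} (hΦ : IsDSSWave ε₀ α π T Φ)
    {B : ℝ} (hB : ∀ r x, ‖Φ r x‖ ≤ B) {r₀ : ρ} {x₀ : ℝ} (hne : Φ r₀ x₀ ≠ 0) :
    (∀ r ξ, ‖ε₀ • Φ r (ε₀ * ξ)‖ ≤ ε₀ * B) ∧ ε₀ * bigLam ε₀ ≤ fluxConst α * (ε₀ * B) * (bigLam ε₀ ^ 2 - 1) := by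
  refine ⟨fun r ξ => ?_, ?_⟩
  · rw [norm_rescale hε.le]; exact mul_le_mul_of_nonneg_left (hB _ _) hε.le
  · have h := dss_amplitude_floor hε hc hΦ hB hne
    have := mul_le_mul_of_nonneg_left h hε.le
    linarith

/-- **SMALL-RATIO NORMAL FORM OF A SURVIVING DSS WAVE.**  Let `Φ` be a non-trivial admissible DSS wave of a cancelling table `α` at
scale ratio `1+ε₀` with delay `T`, (S₁)-surviving, with profiles bounded by `B`.  Then `Ψ_r(ξ) = ε₀·Φ_r(ε₀ξ)` is a solution of the
profile system of `α` with damping `ε₀`, feed `Λ`, drain `Λ⁻¹` and lag `τ = T/ε₀ ∈ [2/(1+ε₀), 5/2)`, with integrable summed mass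
of the SAME total `∫ sMass Φ`, weighted energy `wEnergy ε₀ Ψ` bounded on a right half-line, profiles bounded by `ε₀B`, and
`ε₀B ≥ ε₀Λ/(C_A(Λ²−1))` (an O(1) floor).  (As `ε₀ → 0`: a front of the uniform lattice with O(1) lag — the object of the tree's
Theorems A/A′.)
[cite: Tao2016AveragedNS, §4 Lemma 4.1 (4.8)–(4.10), §6.4; cell vocabulary; this file] -/
theorem smallRatio_normalForm {ε₀ : ℝ} (hε : 0 < ε₀) {α : Fin m → Fin m → Fin m → ℤ × ℤ × ℤ → ℝ}
    (hc : IsCancellingCoeff α) {π : Equiv.Perm ρ} {T : ℝ} {Φ : ρ → ℝ → Em m} (hΦ : IsDSSWave ε₀ α π T Φ)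
    (hS : Surviving 1 ε₀ T) {B : ℝ} (hB : ∀ r x, ‖Φ r x‖ ≤ B) {r₀ : ρ} {x₀ : ℝ} (hne : Φ r₀ x₀ ≠ 0) :
    IsSWave π (tableQ α) (tableA α) (tableB α) ε₀ (bigLam ε₀) (bigLam ε₀)⁻¹ (T / ε₀) (fun r ξ => ε₀ • Φ r (ε₀ * ξ)) ∧
      (2 / (1 + ε₀) ≤ T / ε₀ ∧ T / ε₀ < 5 / 2) ∧
      Integrable (sMass (fun r ξ => ε₀ • Φ r (ε₀ * ξ))) ∧ (∫ ξ, sMass (fun r ξ => ε₀ • Φ r (ε₀ * ξ)) ξ = ∫ x, sMass Φ x) ∧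
      (∃ ξ₀ P : ℝ, ∀ ξ, ξ₀ ≤ ξ → wEnergy ε₀ (fun r ξ => ε₀ • Φ r (ε₀ * ξ)) ξ ≤ P) ∧
      (∀ r ξ, ‖ε₀ • Φ r (ε₀ * ξ)‖ ≤ ε₀ * B) ∧ ε₀ * bigLam ε₀ ≤ fluxConst α * (ε₀ * B) * (bigLam ε₀ ^ 2 - 1) := by
  obtain ⟨hB', hfloor⟩ := rescaled_amplitude_floor hε hc hΦ hB hne
  refine ⟨isSWave_rescale hε hΦ.wave, rescaled_lag_window hε hS, integrable_sMass_rescale hε hΦ.mass,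
    integral_sMass_rescale hε Φ, ?_, hB', hfloor⟩
  obtain ⟨x₀', P, hP⟩ := hΦ.bdd
  refine ⟨x₀' / ε₀, ε₀ ^ 2 * P, fun ξ hξ => ?_⟩
  rw [wEnergy_rescale hε.le]
  have hx : x₀' ≤ ε₀ * ξ := by rwa [div_le_iff₀' hε] at hξ
  exact mul_le_mul_of_nonneg_left (hP _ hx) (sq_nonneg _)

end Summit.NavierStokesRegularity.NavierStokesRegularity.Theorems.NoSurvivingDSSOne.NormalForm

end
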